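import Summits.PneNP.PneNP.Theses.HeisenbergSparsestCut

/-!
# Second birth skeleton for the piece `SosOptimalForSparsestCut` (stmt-PneNP-18995): the LIFTING line

The UNCONDITIONAL direction for SOS optimality (where the engine piece `LasserreCutMetricsFarFromL1` is
indispensable): Lee–Raghavendra–Steurer lifting (arXiv:1411.6317, "Lower bounds on the size of semidefinite
programming relaxations": polynomial-size SDP relaxations are no stronger than degree-O(1) SOS; LP analogue
Chan–Lee–Raghavendra–Steurer arXiv:1309.0563, Kothari–Meka–Raghavendra arXiv:1610.02704), split as

* `stub_capture` (conjecture-grade, the named CAPTURE GAP in its sharp form): a polynomial-time `C`-approximation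
  of non-uniform sparsest cut is matched by polynomial-size SDP relaxations of some constant ratio `C'` —
  "efficient approximation algorithms for cut problems are semidefinite programs";
* `stub_lrsLifting` (theorem-grade in the LRS framework, to be adapted from Max-CSPs to the family of degree-2
  cut functions `x ↦ b·cap(δx) − a·dem(δx)`, closed under planting into more vertices): polynomial-size SDP
  relaxations of constant ratio are matched by a FIXED SOS degree `d` with constant rounding ratio `D` on every
  real-weighted instance (verbatim the conclusion of the piece).

SDP relaxations are typed inline as spectrahedral shadows: `K = A '' {M ⪰ 0, B_k(M) = β_k}` in the space of
real functions on ordered pairs of `Fin m`, containing every cut semimetric, of size `r ≤ (m+2)^c`.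
-/

set_option linter.dupNamespace false

namespace Summit.PneNP.PneNP.Cruxes.NoConstantApproxSparsestCut.BirthSosOptimalLifting

open Summit.PneNP.PneNP.Theses.HeisenbergSparsestCut
open Literature.Computability.MetaComplexity

/-- The cut semimetric of `S` on ordered pairs: `|𝟙_S i − 𝟙_S j|`. -/
noncomputable def cutInd {m : ℕ} (S : Finset (Fin m)) (i j : Fin m) : ℝ :=
  |(if i ∈ S then (1 : ℝ) else 0) - (if j ∈ S then (1 : ℝ) else 0)|

/-- Rounding-ratio guarantee `D` of a set `K` of fractional "cut metrics" on `Fin m`: on every instance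
(`cap, dem ≥ 0`) every `x ∈ K` with positive fractional demand is matched, up to the factor `D`, by a cut. -/
def RatioGuarantee (m : ℕ) (K : Set (Fin m → Fin m → ℝ)) (D : ℝ) : Prop :=
  ∀ cap dem : Fin m → Fin m → ℝ, (∀ i j, 0 ≤ cap i j) → (∀ i j, 0 ≤ dem i j) →
    ∀ x ∈ K, 0 < ∑ i, ∑ j, dem i j * x i j →
      ∃ S : Finset (Fin m), 0 < ∑ i, ∑ j, dem i j * cutInd S i j ∧
        (∑ i, ∑ j, cap i j * cutInd S i j) * (∑ i, ∑ j, dem i j * x i j) ≤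
          D * (∑ i, ∑ j, dem i j * cutInd S i j) * (∑ i, ∑ j, cap i j * x i j)

/-- `K` is an SDP relaxation of the cuts of `Fin m` of size `r`: a linear image of an affine slice of the PSD
cone of `r × r` real matrices (a spectrahedral shadow) containing every cut semimetric. -/
def IsSdpRelaxation (m r : ℕ) (K : Set (Fin m → Fin m → ℝ)) : Prop :=
  (∀ S : Finset (Fin m), cutInd S ∈ K) ∧
  ∃ (A : Matrix (Fin r) (Fin r) ℝ →ₗ[ℝ] (Fin m → Fin m → ℝ)) (q : ℕ)
    (B : Fin q → (Matrix (Fin r) (Fin r) ℝ →ₗ[ℝ] ℝ)) (β : Fin q → ℝ),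
    K = {x | ∃ M : Matrix (Fin r) (Fin r) ℝ, M.PosSemidef ∧ (∀ k, B k M = β k) ∧ A M = x}

/-- The degree-`d` Lasserre "metrics" on `Fin m`: pseudo-cut-metrics of degree-`d` Booleanity pseudoexpectations. -/
def SosMetrics (m d : ℕ) : Set (Fin m → Fin m → ℝ) :=
  {x | ∃ E : MvPolynomial ℕ ℝ →ₗ[ℝ] ℝ, IsPseudoexpectation d E ∧
    (∀ i : ℕ, SatisfiesIdentity d E (boolAxiom i)) ∧
    x = fun i j : Fin m => E ((MvPolynomial.X (i : ℕ) - MvPolynomial.X (j : ℕ)) ^ 2)}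

/-- Polynomial-size SDP relaxations of constant ratio exist for non-uniform sparsest cut. -/
def PolySizeSdpApprox : Prop :=
  ∃ (c : ℕ) (C' : ℝ), 0 < C' ∧ ∀ m : ℕ, ∃ r : ℕ, r ≤ (m + 2) ^ c ∧
    ∃ K : Set (Fin m → Fin m → ℝ), IsSdpRelaxation m r K ∧ RatioGuarantee m K C'

/-- Statement of STUB 1 (conjecture-grade; the capture gap, sharp form): a polynomial-time constant-factor
approximation of non-uniform sparsest cut (`Gap_C ∈ PromiseP`) is matched by polynomial-size SDP relaxations of
constant ratio. -/
def CaptureBySdp : Prop :=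
  ∀ C : ℕ, 1 ≤ C → Literature.Computability.Complexity.PromiseProblem.ofEncoding (Literature.Computability.Complexity.encodingNatMatrix.pairBool (Computability.encodingNatBool.pairBool Computability.encodingNatBool)) {p | ∃ S : Finset (Fin p.1.1), 0 < Literature.Computability.Complexity.cutWeight (fun i j => if i < j then p.1.2 j i else p.1.2 i j) S ∧ Literature.Computability.Complexity.cutWeight (fun i j => if i < j then p.1.2 i j else p.1.2 j i) S * p.2.2 ≤ p.2.1 * Literature.Computability.Complexity.cutWeight (fun i j => if i < j then p.1.2 j i else p.1.2 i j) S} {p | ∀ S : Finset (Fin p.1.1), 0 < Literature.Computability.Complexity.cutWeight (fun i j => if i < j then p.1.2 j i else p.1.2 i j) S → C * p.2.1 * Literature.Computability.Complexity.cutWeight (fun i j => if i < j then p.1.2 j i else p.1.2 i j) S < Literature.Computability.Complexity.cutWeight (fun i j => if i < j then p.1.2 i j else p.1.2 j i) S * p.2.2} ∈ Literature.Computability.Complexity.PromiseP → PolySizeSdpApprox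

/-- Statement of STUB 2 (theorem-grade in the Lee–Raghavendra–Steurer framework, arXiv:1411.6317, adapted to cut
functions): polynomial-size SDP relaxations of constant ratio are matched by a fixed SOS degree with constant
rounding ratio on every real-weighted instance. -/
def LrsLifting : Prop :=
  PolySizeSdpApprox → ∃ (d : ℕ) (D : ℝ), 0 < D ∧ ∀ m : ℕ, RatioGuarantee m (SosMetrics m d) D

/-- STUB 1: capture of polynomial time by polynomial-size SDP relaxations (for this problem). -/
theorem stub_capture : CaptureBySdp := by
  sorry

/-- STUB 2: LRS lifting, poly-size SDP ⟹ fixed-degree SOS. -/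
theorem stub_lrsLifting : LrsLifting := by
  sorry

/-- COMPOSITION (kernel-checked; the only theorem of this file concluding the piece, so that the skeleton
audit is unambiguous): the piece from the two registered stubs, unfolding `RatioGuarantee (SosMetrics m d)`.
Its only `sorry`s are inside `stub_capture` / `stub_lrsLifting`. -/
theorem SosOptimalForSparsestCut_of : SosOptimalForSparsestCut := by
  intro C hC hmem
  obtain ⟨d, D, hD, h⟩ := stub_lrsLifting (stub_capture C hC hmem)
  refine ⟨d, D, hD, fun m cap dem hcap hdem E hE hB hpos => ?_⟩
  exact h m cap dem hcap hdem _ ⟨E, hE, hB, rfl⟩ hpos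

end Summit.PneNP.PneNP.Cruxes.NoConstantApproxSparsestCut.BirthSosOptimalLifting
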